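import Summits.QuantumFields.YangMills.Theorems.UnitScaleTiltProp7BlendGrowth
import Summits.QuantumFields.YangMills.Theorems.UnitScaleTiltProp7CompactChart
import Summits.QuantumFields.YangMills.Theorems.UnitScaleTiltProp7BlendSite
import HarnessLib

/-!
# Route `UnitScaleTilt`, crux K1 child «MinimiserStabilityRegPr» (stmt-QuantumFields-19200), registered stub `stub_prop7From14` (skeleton birth_v7
# cc37a178…; leaf V3 «Prop 7 from a background (14)») — CLAUSE 1 (uniqueness of the critical orbit) AT A MEMBER AND A DATUM FROM ONE REPRESENTATIVE
# SCHEMA: a (4)-representative with a sup bound, an ℓ² Poincaré inequality and a first-variation lower bound ⟹ `AtMostOneCriticalOrbit ε₀ V`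

Cell `ym3-torus` ∕ fleet seat `ym-ust-19200-p1` (gen 9; HUMAN RULING D-0037, YM ladder rung R3).  WHY.  The assembly S5 of the blended-comb-gauge line
(CARD-19200-V3-g9 §3), kernel-checked: gen 6's `Prop7CompactChart.atMostOneCriticalOrbit_of_exists_reprGrowth` asks, for every pair of reading-R2
critical `U, W ∈ (6)(ε₀) ∩ fibre(V)`, for SOME `v` in print's group (4) and SOME `κ > 0` with `κ·Σ_b‖(W^v)_bU_b⁻¹ − 1‖² ≤ A(W^v) − A(U)`; gen 9's
`Prop7BlendGrowth.growth_of_poincare_T3` (gen 2's Taylor expansion with the curl factor, summed) turns a sup bound `s ≤ 1`, an ℓ² Poincaré inequality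
(constant `C_P`) and a lower bound `−C_L·Σ‖Y‖²` on the exact first-order term into such a `κ`, namely `κ = (1/(16C_P))L^{−2(K−n)} − 12(2a² + 128s² + 8a) − C_L`,
`a = ε₀L^{−2(K−n)}`, whenever this number is positive.  So CLAUSE 1 at `(V, ε₀)` follows from ONE schema on the representative: this file states it and
proves the implication.  The blended comb gauge (`Prop7BlendedGauge.exists_blendedGauge_T3`) supplies the (4)-element and the sup bound `s = 551088·2ε₀·L^{−(K−n)}`;
the Poincaré inequality for it (S2) and the first-variation bound from R2-minimality (S4, `C_L = O(ε₀)L^{−2(K−n)}` via the divergence clause of (6)) are the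
two open stubs of the line, after which `κ > 0` for `ε₀ ≤ a₀` with `a₀` absolute.

WHAT IS PROVED (sorry-free, no definition).  `pertVar_eq_mul_star`, `plaq_le_of_regPr`; **`atMostOneCriticalOrbit_of_reprSchema_T3`**.

HONEST SCOPE.  An implication between displayed hypotheses and clause 1 at one member/datum; nothing of [Balaban1985Variational] is asserted; count-neutral
helper toward stmt-QuantumFields-19200 (`--supports`).

References: T. Bałaban, CMP 102 (1985) 277–309 [Balaban1985Variational] (Prop. 7 p.299, (141)–(143) p.299, (26)–(31) pp.282–283).
-/

noncomputable section

open scoped BigOperators Matrix.Norms.L2Operator Matrix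

namespace Summit.QuantumFields.YangMills.Theorems.Prop7BlendClause1

open Literature.MathematicalPhysics.QuantumFieldTheory.Balaban1983to89
open Literature.MathematicalPhysics.QuantumFieldTheory.Balaban1983to89.T3ContinuumYM3Torus
open Literature.MathematicalPhysics.QuantumFieldTheory.Balaban1983to89.T3PrintedRegularMinimiser (RegPr regFibrePr mem_regFibrePr_iff)
open Literature.MathematicalPhysics.QuantumFieldTheory.Balaban1983to89.T3PrintedRegularOrbits (descTransf)
open Literature.MathematicalPhysics.QuantumFieldTheory.Balaban1983to89.T3Thm1Carrier
open Literature.MathematicalPhysics.QuantumFieldTheory.Balaban1983to89.T3Thm1CarrierNative (IsCritR2)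
open BlockAveragingEMLLinearisedBackground (pertVar)
open Summit.QuantumFields.YangMills.Theorems.Prop7BlendGrowth (growth_of_poincare_T3)
open Summit.QuantumFields.YangMills.Theorems.Prop7BlendSite (coe_inv_SU)
open Summit.QuantumFields.YangMills.Theorems.Prop7CompactChart (atMostOneCriticalOrbit_of_exists_reprGrowth)

section T3

variable (F : T3Family) {n K : ℕ} (h : n ≤ K)

/-- `pertVar U₀ U b = ↑U_b·(↑U₀,b)* − 1`. [cite: Balaban1985Variational, (15) p.280] -/
theorem pertVar_eq_mul_star {P : Params} {j : ℕ} (U₀ U : GaugeField P j (Matrix.specialUnitaryGroup (Fin 2) ℂ)) (b : PBond P j) :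
    pertVar U₀ U b = (U b : Matrix (Fin 2) (Fin 2) ℂ) * star (U₀ b : Matrix (Fin 2) (Fin 2) ℂ) - 1 := by
  rw [pertVar, Submonoid.coe_mul, coe_inv_SU]

/-- The plaquette clause of `RegPr` in the form `dist1 U(∂p) ≤ ε₀·(L^{K−n})^{−2}`. [cite: Balaban1985Variational, (2) p.278] -/
theorem plaq_le_of_regPr {ε₀ : ℝ} {U : GaugeField (F.P K) 0 (Matrix.specialUnitaryGroup (Fin 2) ℂ)} (hreg : RegPr F n K ε₀ U)
    (p : Plaq (F.P K) 0) : dist1 (GaugeField.plaqHol U p) ≤ ε₀ * (((F.L : ℝ) ^ (K - n)) ^ 2)⁻¹ := by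
  have h1 := (hreg.plaqSmall p).le
  have h2 : T3RegularMinimiser.regThreshold F n K ε₀ = ε₀ * (((F.L : ℝ) ^ (K - n)) ^ 2)⁻¹ := by
    rw [T3RegularMinimiser.regThreshold, inv_pow, mul_comm 2 (K - n), pow_mul]
  rwa [h2] at h1

/-- **CLAUSE 1 AT `(V, ε₀)` FROM ONE REPRESENTATIVE SCHEMA.**  If for every pair of reading-R2 critical `U, W ∈ (6)(ε₀) ∩ fibre(V)` there is `g` with `g↓ = 1`
such that `Y_b = (W^g)_bU_b* − 1` satisfies (i) `‖Y_b‖ ≤ s` (`s ≤ 1`), (ii) the ℓ² POINCARÉ inequality `Σ_b‖Y_b‖² ≤ C_P·L^{2(K−n)}·Σ_p|C_p(Y)|²_HS` and (iii) the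
first-variation bound `Lin_U(Y) ≥ −C_L·Σ_b‖Y_b‖²`, and if `κ := (1/(16C_P))L^{−2(K−n)} − 12(2a² + 128s² + 8a) − C_L > 0` (`a = ε₀L^{−2(K−n)}`), then any two
reading-R2 critical configurations of `(6)(ε₀) ∩ fibre(V)` lie on one orbit of print's group (4). [cite: Balaban1985Variational, Prop. 7 p.299, (141)-(143) p.299] -/
theorem atMostOneCriticalOrbit_of_reprSchema_T3 {ε₀ CP CL s : ℝ} (hε : 0 ≤ ε₀) (hCP : 0 < CP) (hs1 : s ≤ 1)
    (V : GaugeField (F.P n) 0 (Matrix.specialUnitaryGroup (Fin 2) ℂ))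
    (hκ : 0 < (1 / (16 * CP)) * (((F.L : ℝ) ^ (K - n)) ^ 2)⁻¹
        - 12 * (2 * (ε₀ * (((F.L : ℝ) ^ (K - n)) ^ 2)⁻¹) ^ 2 + 128 * s ^ 2 + 8 * (ε₀ * (((F.L : ℝ) ^ (K - n)) ^ 2)⁻¹)) - CL)
    (hrepr : ∀ U W : GaugeField (F.P K) 0 (Matrix.specialUnitaryGroup (Fin 2) ℂ),
      U ∈ regFibrePr F n K h ε₀ V → IsCritR2 F n K h V U → W ∈ regFibrePr F n K h ε₀ V → IsCritR2 F n K h V W →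
        ∃ g : GaugeTransf (F.P K) 0 (Matrix.specialUnitaryGroup (Fin 2) ℂ), descTransf F n K h g = (fun _ => 1) ∧
          (∀ b : PBond (F.P K) 0, ‖pertVar U (GaugeField.gaugeAct g W) b‖ ≤ s) ∧
          (∑ b : PBond (F.P K) 0, ‖pertVar U (GaugeField.gaugeAct g W) b‖ ^ 2 ≤
            CP * ((F.L : ℝ) ^ (K - n)) ^ 2 * ∑ p : Plaq (F.P K) 0, ∑ i₁ : Fin 2, ∑ i₂ : Fin 2,
              ‖((((GaugeField.gaugeAct g W ⟨p.src, p.μ⟩ : Matrix.specialUnitaryGroup (Fin 2) ℂ) : Matrix (Fin 2) (Fin 2) ℂ) * star (U ⟨p.src, p.μ⟩ : Matrix (Fin 2) (Fin 2) ℂ) - 1)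
                  + (U ⟨p.src, p.μ⟩ : Matrix (Fin 2) (Fin 2) ℂ)
                      * (((GaugeField.gaugeAct g W ⟨p.src.shift p.μ, p.ν⟩ : Matrix.specialUnitaryGroup (Fin 2) ℂ) : Matrix (Fin 2) (Fin 2) ℂ) *
                          star (U ⟨p.src.shift p.μ, p.ν⟩ : Matrix (Fin 2) (Fin 2) ℂ) - 1)
                      * star (U ⟨p.src, p.μ⟩ : Matrix (Fin 2) (Fin 2) ℂ)
                  - (U ⟨p.src, p.ν⟩ : Matrix (Fin 2) (Fin 2) ℂ)
                      * (((GaugeField.gaugeAct g W ⟨p.src.shift p.ν, p.μ⟩ : Matrix.specialUnitaryGroup (Fin 2) ℂ) : Matrix (Fin 2) (Fin 2) ℂ) *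
                          star (U ⟨p.src.shift p.ν, p.μ⟩ : Matrix (Fin 2) (Fin 2) ℂ) - 1)
                      * star (U ⟨p.src, p.ν⟩ : Matrix (Fin 2) (Fin 2) ℂ)
                  - (((GaugeField.gaugeAct g W ⟨p.src, p.ν⟩ : Matrix.specialUnitaryGroup (Fin 2) ℂ) : Matrix (Fin 2) (Fin 2) ℂ) * star (U ⟨p.src, p.ν⟩ : Matrix (Fin 2) (Fin 2) ℂ) - 1))
                i₁ i₂‖ ^ 2) ∧
          (-CL * ∑ b : PBond (F.P K) 0, ‖pertVar U (GaugeField.gaugeAct g W) b‖ ^ 2 ≤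
            ∑ p : Plaq (F.P K) 0, (1 / 2) * ((((((GaugeField.plaqHol U p : Matrix.specialUnitaryGroup (Fin 2) ℂ) : Matrix (Fin 2) (Fin 2) ℂ)) - 1)ᴴ
              * (((((GaugeField.gaugeAct g W ⟨p.src, p.μ⟩ : Matrix.specialUnitaryGroup (Fin 2) ℂ) : Matrix (Fin 2) (Fin 2) ℂ) * star (U ⟨p.src, p.μ⟩ : Matrix (Fin 2) (Fin 2) ℂ) - 1)
                  + (U ⟨p.src, p.μ⟩ : Matrix (Fin 2) (Fin 2) ℂ)
                      * (((GaugeField.gaugeAct g W ⟨p.src.shift p.μ, p.ν⟩ : Matrix.specialUnitaryGroup (Fin 2) ℂ) : Matrix (Fin 2) (Fin 2) ℂ) *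
                          star (U ⟨p.src.shift p.μ, p.ν⟩ : Matrix (Fin 2) (Fin 2) ℂ) - 1)
                      * star (U ⟨p.src, p.μ⟩ : Matrix (Fin 2) (Fin 2) ℂ)
                  - ((U ⟨p.src, p.μ⟩ * U ⟨p.src.shift p.μ, p.ν⟩ * (U ⟨p.src.shift p.ν, p.μ⟩)⁻¹ : Matrix.specialUnitaryGroup (Fin 2) ℂ) :
                        Matrix (Fin 2) (Fin 2) ℂ)
                      * (((GaugeField.gaugeAct g W ⟨p.src.shift p.ν, p.μ⟩ : Matrix.specialUnitaryGroup (Fin 2) ℂ) : Matrix (Fin 2) (Fin 2) ℂ) *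
                          star (U ⟨p.src.shift p.ν, p.μ⟩ : Matrix (Fin 2) (Fin 2) ℂ) - 1)
                      * star ((U ⟨p.src, p.μ⟩ * U ⟨p.src.shift p.μ, p.ν⟩ * (U ⟨p.src.shift p.ν, p.μ⟩)⁻¹ : Matrix.specialUnitaryGroup (Fin 2) ℂ) :
                        Matrix (Fin 2) (Fin 2) ℂ)
                  - ((GaugeField.plaqHol U p : Matrix.specialUnitaryGroup (Fin 2) ℂ) : Matrix (Fin 2) (Fin 2) ℂ)
                      * (((GaugeField.gaugeAct g W ⟨p.src, p.ν⟩ : Matrix.specialUnitaryGroup (Fin 2) ℂ) : Matrix (Fin 2) (Fin 2) ℂ) * star (U ⟨p.src, p.ν⟩ : Matrix (Fin 2) (Fin 2) ℂ) - 1)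
                      * star ((GaugeField.plaqHol U p : Matrix.specialUnitaryGroup (Fin 2) ℂ) : Matrix (Fin 2) (Fin 2) ℂ))
                * ((GaugeField.plaqHol U p : Matrix.specialUnitaryGroup (Fin 2) ℂ) : Matrix (Fin 2) (Fin 2) ℂ))).trace).re)) :
    (varProblem3 F n K h).AtMostOneCriticalOrbit ε₀ V := by
  refine atMostOneCriticalOrbit_of_exists_reprGrowth F h hε V fun U W hU hcU hW hcW => ?_
  obtain ⟨g, hg4, hsup, hP, hlin⟩ := hrepr U W hU hcU hW hcW
  refine ⟨g, hg4, _, hκ, ?_⟩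
  have hUr : RegPr F n K ε₀ U := ((mem_regFibrePr_iff F).mp hU).2
  -- the representative in the letters of `growth_of_poincare_T3`
  have hY : ∀ b : PBond (F.P K) 0, pertVar U (GaugeField.gaugeAct g W) b =
      ((GaugeField.gaugeAct g W b : Matrix.specialUnitaryGroup (Fin 2) ℂ) : Matrix (Fin 2) (Fin 2) ℂ) * star (U b : Matrix (Fin 2) (Fin 2) ℂ) - 1 :=
    fun b => pertVar_eq_mul_star U (GaugeField.gaugeAct g W) b
  simp only [hY] at hsup hP hlin ⊢
  have hG := growth_of_poincare_T3 F n K (GaugeField.gaugeAct g W) U hε hCP (plaq_le_of_regPr F hUr) hsup hs1 hP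
  have hsq : 0 ≤ ∑ b : PBond (F.P K) 0, ‖((GaugeField.gaugeAct g W b : Matrix.specialUnitaryGroup (Fin 2) ℂ) : Matrix (Fin 2) (Fin 2) ℂ) * star (U b : Matrix (Fin 2) (Fin 2) ℂ) - 1‖ ^ 2 :=
    Finset.sum_nonneg fun b _ => sq_nonneg _
  rw [sub_mul]
  linarith

end T3

end Summit.QuantumFields.YangMills.Theorems.Prop7BlendClause1

end
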